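import Mathlib
import Literature.Barriers.ValiantsHypothesis.AlgebraicNaturalProofs
import Literature.Computability.AlgebraicComplexity.FastSeriesCircuits
import Literature.Computability.AlgebraicComplexity.SeriesInverseCircuit
import Summits.ValiantsHypothesis.ValiantsHypothesis.Theorems.BarrierLeverSuccinctHittingSetsForVPCentralBinomialTwoWitness
import HarnessLib

/-!
# The all-ones polynomial `Σ_{|m| ≤ n} x^m` in `SmallCircuits ℂ n 2` (crux stmt-ValiantsHypothesis-14610
side; seat val-np-p5)

**What is proved (unconditional; a helper for the 14610-side rows; it does NOT close any item).**
The tree's row "all-ones polynomial" — `exists_allOnes_mem_smallCircuits` (exponent `8`) /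
`CatalecticantThree.exists_allOnes_mem_smallCircuits_three` (exponent `3`, the truncated-product dynamic
programme) — moves to the open rung: `exists_allOnes_mem_smallCircuits_two`, for `n ≥ 8192` some
`f ∈ SmallCircuits ℂ n 2` has `coeff_m f = 1` for every `m` of degree `≤ n`.

The circuit: `A_n = Σ_{|m| ≤ n} x^m = Σ_{d ≤ n} h_d(x) = Σ_{d ≤ n} [s^d] σ` with `σ = ∏_l (1 − x_l s)^{-1}`
(`sigma_mul_p`); the `n + 1` coefficients of `P(s) = ∏_l (1 − x_l s)` by the FFT product tree
(`jointlyComputed_prod_linear`), the first `2^J ≥ n + 1` coefficients of `σ = P^{-1}` by Newton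
inversion with FFT multiplication (`jointlyComputed_inv`, `SeriesInverseCircuit.lean`), and their sum:
`≤ n + prodTreeCost K + invCost J + n ≤ n (32L² + 48L + 134) ≤ n²` for `n ≥ 2^{13}`, `K = J = L =
⌈log₂(n+1)⌉`.  (Also: all complete homogeneous symmetric polynomials `h_0, …, h_n` of `n` variables
are jointly computed in `O(n log² n)` gates — `jointlyComputed` form inside the proof.)

Honest framing: 14610-side bookkeeping at `b = 2`; nothing here bears on the dense heart of 14610 or on
VP ≠ VNP.

References: von zur Gathen–Gerhard §9.1, §10.1; [ForbesShpilkaVolk2018] §1.2, Construction 25.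
-/

-- layout Summits/ValiantsHypothesis/ValiantsHypothesis forces the duplicated namespace component
set_option linter.dupNamespace false

noncomputable section

namespace Summit.ValiantsHypothesis.ValiantsHypothesis.Theorems.BarrierLever.SuccinctHittingSetsForVP

open Literature.Barriers.ValiantsHypothesis Literature.Computability.AlgebraicComplexity MvPolynomial

namespace AllOnesTwo

open Finset

variable (n : ℕ)

/-- The geometric series `G_l = Σ_j x_l^j s^j`. [folklore] -/
def gser (l : Fin n) : PowerSeries (MvPolynomial (Fin n) ℂ) :=
  PowerSeries.mk fun j => X l ^ j

/-- The linear factor `1 − x_l s` (in the shape used by `jointlyComputed_prod_linear`). [folklore] -/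
def linPoly (l : Fin n) : Polynomial (MvPolynomial (Fin n) ℂ) :=
  Polynomial.C ((-1 : ℂ) • X l) * Polynomial.X + Polynomial.C 1

/-- `P(s) = ∏_l (1 − x_l s)`. [folklore] -/
def pPoly : Polynomial (MvPolynomial (Fin n) ℂ) := ∏ l, linPoly n l

/-- `σ = ∏_l G_l = Σ_d h_d(x) s^d`. [folklore] -/
def sigma : PowerSeries (MvPolynomial (Fin n) ℂ) := ∏ l, gser n l

/-- `G_l · (1 − x_l s) = 1`. [folklore] -/
theorem gser_mul_lin (l : Fin n) :
    gser n l * (linPoly n l : PowerSeries (MvPolynomial (Fin n) ℂ)) = 1 := by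
  have hlin : (linPoly n l : PowerSeries (MvPolynomial (Fin n) ℂ)) =
      PowerSeries.C ((-1 : ℂ) • X l) * PowerSeries.X + 1 := by
    simp [linPoly, Polynomial.coe_add, Polynomial.coe_mul, Polynomial.coe_C, Polynomial.coe_X]
  rw [hlin, mul_add, mul_one]
  ext j
  rcases j with _ | j
  · simp [gser, ← mul_assoc]
  · rw [map_add, ← mul_assoc, PowerSeries.coeff_succ_mul_X, PowerSeries.coeff_mul_C, gser,
      PowerSeries.coeff_mk, PowerSeries.coeff_mk, PowerSeries.coeff_one, if_neg (Nat.succ_ne_zero _),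
      neg_one_smul, pow_succ]
    ring

/-- **`σ · P = 1`**. [folklore] -/
theorem sigma_mul_p : sigma n * (pPoly n : PowerSeries (MvPolynomial (Fin n) ℂ)) = 1 := by
  have hP : (pPoly n : PowerSeries (MvPolynomial (Fin n) ℂ)) =
      ∏ l, (linPoly n l : PowerSeries (MvPolynomial (Fin n) ℂ)) := by
    rw [pPoly, ← Polynomial.coeToPowerSeries.ringHom_apply, map_prod]
    rfl
  rw [hP, sigma, ← prod_mul_distrib]
  exact prod_eq_one fun l _ => gser_mul_lin n l

/-- `σ(0) = 1`. [folklore] -/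
theorem coeff_zero_sigma : PowerSeries.coeff 0 (sigma n) = 1 := by
  rw [PowerSeries.coeff_zero_eq_constantCoeff_apply, sigma, map_prod]
  refine prod_eq_one fun l _ => ?_
  rw [gser, PowerSeries.constantCoeff_mk]
  simp

/-- `deg_s P ≤ n`. [folklore] -/
theorem natDegree_pPoly_le : (pPoly n).natDegree ≤ n := by
  rw [pPoly]
  refine (Polynomial.natDegree_prod_le _ _).trans ?_
  calc ∑ l : Fin n, (linPoly n l).natDegree ≤ ∑ _l : Fin n, 1 :=
        sum_le_sum fun l _ => Polynomial.natDegree_linear_le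
    _ = n := by simp

/-- **The `s^d` coefficient of `σ`** is `h_d = Σ_{|μ| = d} x^μ`. [folklore] -/
theorem coeff_sigma (d : ℕ) :
    PowerSeries.coeff d (sigma n) =
      ∑ μ ∈ (univ : Finset (Fin n)).finsuppAntidiag d, monomial μ (1 : ℂ) := by
  classical
  rw [sigma, PowerSeries.coeff_prod]
  refine sum_congr rfl fun μ _ => ?_
  simp only [gser, PowerSeries.coeff_mk]
  have h := CentralBinomialTwo.prod_C_mul_X_pow n μ (fun _ => (1 : ℂ))
  simp only [C_1, one_mul, prod_const_one] at h
  exact h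

/-- The `x^μ`-coefficient of the `s^d` coefficient of `σ`. [folklore] -/
theorem mvcoeff_coeff_sigma (d : ℕ) (μ : Fin n →₀ ℕ) :
    MvPolynomial.coeff μ (PowerSeries.coeff d (sigma n)) = if μ.degree = d then 1 else 0 := by
  classical
  rw [coeff_sigma, coeff_sum]
  simp only [coeff_monomial]
  rw [sum_ite_eq']
  have hmem : μ ∈ (univ : Finset (Fin n)).finsuppAntidiag d ↔ μ.degree = d := by
    rw [mem_finsuppAntidiag, Finsupp.degree_eq_sum]
    simp
  by_cases h : μ.degree = d
  · rw [if_pos (hmem.2 h), if_pos h]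
  · rw [if_neg (fun h' => h (hmem.1 h')), if_neg h]

/-- **The all-ones polynomial** `A_n = Σ_{d ≤ n} [s^d] σ = Σ_{|m| ≤ n} x^m` (written as the partial
sum the circuit computes). [folklore] -/
def allOnes : MvPolynomial (Fin n) ℂ :=
  ∑ d ∈ range (n + 1), PowerSeries.coeff d (sigma n)

/-- `coeff_μ A_n = 1` for `|μ| ≤ n`, else `0`. [folklore] -/
theorem coeff_allOnes (μ : Fin n →₀ ℕ) :
    MvPolynomial.coeff μ (allOnes n) = if μ.degree ≤ n then 1 else 0 := by
  rw [allOnes, coeff_sum]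
  simp only [mvcoeff_coeff_sigma]
  rw [sum_ite_eq]
  simp only [mem_range, Nat.lt_succ_iff]

/-- `A_n` has total degree `≤ n`. [folklore] -/
theorem totalDegree_allOnes_le : (allOnes n).totalDegree ≤ n := by
  rw [totalDegree]
  refine Finset.sup_le fun μ hμ => ?_
  rw [mem_support_iff, coeff_allOnes] at hμ
  by_cases h : μ.degree ≤ n
  · have : (μ.sum fun _ e => e) = μ.degree := rfl
    rw [this]; exact h
  · exact absurd (if_neg h) hμ

/-- **Size of `A_n`**: `complexity A_n ≤ n + prodTreeCost K + invCost J + n` whenever `n ≤ 2^K` and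
`n + 1 ≤ 2^J` (leaves, FFT product tree for `P`, Newton inversion, final sum).
[cite: ForbesShpilkaVolk2018, Construction 25] -/
theorem complexity_allOnes_le (K J : ℕ) (hK : n ≤ 2 ^ K) (hJ : n + 1 ≤ 2 ^ J) :
    complexity (allOnes n) ≤ n + prodTreeCost K + invCost J + n := by
  classical
  have hζ : ∀ κ, κ ≠ 0 → CentralBinomialTwo.zeta κ ^ 2 ^ (κ - 1) = -1 := CentralBinomialTwo.zeta_pow
  have ht : ∀ κ, ((2 : ℂ) ^ κ) * ((2 : ℂ) ^ κ)⁻¹ = 1 := fun κ =>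
    mul_inv_cancel₀ (pow_ne_zero _ two_ne_zero)
  let u : Fin n ⊕ Unit → MvPolynomial (Fin n) ℂ := Sum.elim (fun l => X l) (fun _ => 1)
  have hu : JointlyComputed u 0 := jointlyComputed_of_inputs u (by
    rintro (l | x)
    · exact Or.inl ⟨l, rfl⟩
    · exact Or.inr ⟨1, by simp [u]⟩)
  have h1 := hu.extend_smul (κ := Fin n) (fun _ => (-1 : ℂ)) (fun l => Sum.inl l)
  rw [Fintype.card_fin, Nat.zero_add] at h1
  have h2 := jointlyComputed_prod_linear CentralBinomialTwo.zeta (fun κ => ((2 : ℂ) ^ κ)⁻¹) hζ ht h1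
    hK (fun _ => (1 : MvPolynomial (Fin n) ℂ)) (fun l => (-1 : ℂ) • X l)
    (fun _ => Sum.inl (Sum.inr ())) (fun l => Sum.inr l) (fun l => rfl) (fun l => rfl)
  have hPc : ∀ j, (n : ℕ) < j → PowerSeries.coeff j
      (pPoly n : PowerSeries (MvPolynomial (Fin n) ℂ)) = 0 := fun j hj => by
    rw [Polynomial.coeff_coe]
    exact Polynomial.coeff_eq_zero_of_natDegree_lt ((natDegree_pPoly_le n).trans_lt hj)
  have h3 := jointlyComputed_inv CentralBinomialTwo.zeta (fun κ => ((2 : ℂ) ^ κ)⁻¹) hζ ht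
    (sigma n) (pPoly n : PowerSeries (MvPolynomial (Fin n) ℂ)) (sigma_mul_p n) (coeff_zero_sigma n)
    n hPc J _ _ (fun j => Sum.inr j) h2 (fun j => by
      simp only [Sum.elim_inr, Polynomial.coeff_coe]
      rfl)
  have h4 := jointlyComputed_sum h3 (fun d => PowerSeries.coeff d (sigma n)) n
    (fun d => Sum.inr ⟨d, by omega⟩) (fun d => rfl)
  have := h4.complexity_le (Sum.inr ())
  simpa [allOnes, Nat.add_assoc] using this

/-- **Size of `A_n` at the open rung**: `complexity A_n ≤ n²` for `n ≥ 8192`.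
[cite: ForbesShpilkaVolk2018, Construction 25] -/
theorem complexity_allOnes_le_sq (hn : 8192 ≤ n) : complexity (allOnes n) ≤ n ^ 2 := by
  set L := Nat.clog 2 (n + 1) with hLdef
  have hpow : n + 1 ≤ 2 ^ L := Nat.le_pow_clog one_lt_two _
  have hlt : 2 ^ (L - 1) < n + 1 := by
    have := Nat.pow_pred_clog_lt_self one_lt_two (x := n + 1) (by omega)
    simpa [Nat.pred_eq_sub_one] using this
  have hL14 : 14 ≤ L := by
    by_contra h
    have h13 : L ≤ 13 := by omega
    have : 2 ^ L ≤ 2 ^ 13 := Nat.pow_le_pow_right (by norm_num) h13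
    omega
  have h2L : 2 ^ L = 2 * 2 ^ (L - 1) := by
    rw [← pow_succ']; congr 1; omega
  have hmain := complexity_allOnes_le n L L (by omega) hpow
  have hT := prodTreeCost_le L
  have hN := invCost_le L
  have hq := CentralBinomialTwo.quad_le_two_pow L hL14
  have h2L1 : 2 ^ (L - 1) ≤ n := by omega
  rw [h2L] at hT
  rw [pow_succ, h2L] at hN
  have hL1 : L ≤ 2 ^ (L - 1) := by
    have := Nat.lt_two_pow_self (n := L - 1); omega
  nlinarith [hmain, hT, hN, hq, h2L1, hL1, Nat.zero_le L, Nat.zero_le (2 ^ (L - 1))]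

/-- `A_n ∈ SmallCircuits ℂ n 2` for `n ≥ 8192`. [cite: ForbesShpilkaVolk2018, Construction 25] -/
theorem allOnes_mem_smallCircuits (hn : 8192 ≤ n) : allOnes n ∈ SmallCircuits ℂ n 2 :=
  ⟨totalDegree_allOnes_le n, complexity_allOnes_le_sq n hn⟩

end AllOnesTwo

/-- **The all-ones polynomial `Σ_{|m| ≤ n} x^m` is a small circuit of exponent 2** (tree:
`exists_allOnes_mem_smallCircuits`, exponent `8`; `CatalecticantThree.exists_allOnes_mem_smallCircuits_three`,
exponent `3`): for `n ≥ 8192` some `f ∈ SmallCircuits ℂ n 2` has `coeff_m f = 1` for every `m` of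
degree `≤ n`. [cite: ForbesShpilkaVolk2018, Construction 25] -/
theorem exists_allOnes_mem_smallCircuits_two (n : ℕ) (hn : 8192 ≤ n) :
    ∃ f ∈ SmallCircuits ℂ n 2, ∀ m : Fin n →₀ ℕ, m.degree ≤ n → coeff m f = 1 := by
  refine ⟨AllOnesTwo.allOnes n, AllOnesTwo.allOnes_mem_smallCircuits n hn, fun m hm => ?_⟩
  rw [AllOnesTwo.coeff_allOnes, if_pos hm]

/-- **The central-binomial polynomial is a small circuit of exponent 2** (companion of
`CatalecticantThree.exists_factorial_mem_smallCircuits_three`, with the arcsine moments `C(2k, k)`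
in place of the Laguerre moments `k!`): for `n ≥ 8192` some `f ∈ SmallCircuits ℂ n 2` has
`coeff_m f = ∏_i C(2 m_i, m_i)` for every `m` of degree `≤ n`. [cite: ForbesShpilkaVolk2018, Construction 25] -/
theorem exists_centralBinom_mem_smallCircuits_two (n : ℕ) (hn : 8192 ≤ n) :
    ∃ f ∈ SmallCircuits ℂ n 2, ∀ m : Fin n →₀ ℕ, m.degree ≤ n →
      coeff m f = ∏ i, (((2 * m i).choose (m i) : ℕ) : ℂ) := by
  refine ⟨CentralBinomialTwo.witness n, CentralBinomialTwo.witness_mem_smallCircuits n hn,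
    fun m hm => ?_⟩
  rw [CentralBinomialTwo.coeff_witness, if_pos hm]

end Summit.ValiantsHypothesis.ValiantsHypothesis.Theorems.BarrierLever.SuccinctHittingSetsForVP

end
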